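import Mathlib
import Literature.AlgebraicGeometry.Morphisms.SteinFactorizationLocalCriterion
import Literature.AlgebraicGeometry.Resolution.AlterationsSemiStableCodimTwoProofs
import Literature.AlgebraicGeometry.Resolution.RegularLocalRingsProofs
import Literature.AlgebraicGeometry.Resolution.MuPTorsorLocalUniformizationRelative
import Summits.ResolutionOfSingularities.ResolutionOfSingularities.Theorems.SoloInformedRankOne
import HarnessLib

/-!
# The residually inseparable exit of the model-form `μ_p`-torsor step (Lemma U)

Summit-side partial result (solo/informed residency, session 5). The local core of the summit
(`SoloInformedFinalCore`, `SoloInformedSeparatingConstants`) is the model-form `μ_p`-torsor step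
`RelMuPTorsorCoreStepsAt`: given a regular local ring `R` (a local ring of a model of `K₀`)
dominated by a valuation `v` of `K₁ = K₀(a)`, `a ^ p = f ∈ R`, produce a regular local ring
`A ⊇ R[a]` essentially of finite type, still dominated by `v`. Session 5 isolates the two EXITS of
this step: the toroidal exit (Lemma T, `f - q^p = u·x^b` with an exponent prime to `p`; on paper)
and the residually inseparable exit, formalised here:

**Lemma U.** If `f - q ^ p = m ^ p · u` with `q, m ∈ R`, `m ≠ 0`, and the residue `ū` of `u` is
NOT a `p`-th power in the residue field of `R`, then `R[(a - q)/m] ≅ R[T]/(T^p - u)` is a regular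
local ring (free of rank `p` over `R`, maximal ideal extended from `𝔪_R`, residue field
`k_R(ū^{1/p})`); it contains `a` and is dominated by every valuation dominating `R`.

The ring-theoretic content is Matsumura's Thm. 23.7 (ii) for the flat local extension
`R → R[T]/(P)`, `P` monic with irreducible reduction (closed fibre = the FIELD `k_R[T]/(P̄)`),
assembled from the tree's `SteinFibre.isLocalRing_adjoinRoot` and
`IsRegularLocalRing.of_flat_of_isField_quotient`, with Mathlib's `X_pow_sub_C_irreducible_of_prime`.
The model-form theorem `exists_model_of_residuallyInseparablePresentation` solves the core step at
every instance with such a presentation over the smaller model, and the last two theorems remove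
these instances from the core: `RelMuPTorsorCoreStepsAt p k O` — and with it the summit, granted
Temkin (height one) and Cossart–Piltant (dim ≤ 3) as in `SoloInformedRankOne` — is equivalent to
the same statement at the instances WITHOUT a residually inseparable presentation.

References: H. Matsumura, *Commutative Ring Theory*, Thm. 23.7 (ii); F.-V. Kuhlmann, A. Rzepka,
*The valuation theory of deeply ramified fields and its connection with defect extensions*,
Trans. AMS 376 (2023), Thm. 2.8, Lemma 2.9 (arXiv:1811.04396), for the role of this exit.
-/

noncomputable section

namespace Summit.ResolutionOfSingularities.ResolutionOfSingularities.Theorems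

open Polynomial IsLocalRing
open Literature.AlgebraicGeometry.Morphisms Literature.AlgebraicGeometry.Morphisms.SteinFibre
open Literature.AlgebraicGeometry.Resolution

universe u

variable {R : Type u} [CommRing R] [IsRegularLocalRing R]

/-- **Matsumura 23.7 (ii), monogenic case.** For a regular local ring `R` and a monic `P ∈ R[T]`
whose reduction modulo `𝔪_R` is irreducible, `R[T]/(P)` is a regular local ring: it is local with
maximal ideal `𝔪_R · R[T]/(P)` (`SteinFibre.isLocalRing_adjoinRoot`), free hence flat over `R`,
`R → R[T]/(P)` is a local homomorphism, and the closed fibre `k_R[T]/(P̄)` is a field.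
[cite: Matsumura1987, Thm. 23.7 (ii)] -/
theorem isRegularLocalRing_adjoinRoot_of_irreducible_map (P : R[X]) (hP : P.Monic)
    (hirr : Irreducible (P.map (residue R))) : IsRegularLocalRing (AdjoinRoot P) := by
  letI : IsLocalRing (AdjoinRoot P) := isLocalRing_adjoinRoot P hP hirr
  haveI : Module.Free R (AdjoinRoot P) := Module.Free.of_basis (AdjoinRoot.powerBasis' hP).basis
  haveI : Module.Flat R (AdjoinRoot P) := inferInstance
  haveI : IsLocalHom (algebraMap R (AdjoinRoot P)) := by
    refine ⟨fun a ha => ?_⟩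
    by_contra hna
    have hmem : algebraMap R (AdjoinRoot P) a ∈ maximalIdeal (AdjoinRoot P) := by
      rw [maximalIdeal_adjoinRoot P hP hirr, AdjoinRoot.algebraMap_eq]
      exact Ideal.mem_map_of_mem _ ((mem_maximalIdeal _).mpr hna)
    exact (mem_maximalIdeal _).mp hmem ha
  have hF : IsField (AdjoinRoot P ⧸ (maximalIdeal R).map (algebraMap R (AdjoinRoot P))) := by
    rw [AdjoinRoot.algebraMap_eq]
    exact (Ideal.Quotient.maximal_ideal_iff_isField_quotient _).mp
      (isMaximal_map_maximalIdeal_adjoinRoot P hirr)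
  exact IsRegularLocalRing.of_flat_of_isField_quotient hF

/-- **Lemma U, ring form (Kummer case).** For a regular local ring `R`, a prime `p` and `u ∈ R`
whose residue is not a `p`-th power in the residue field (in particular `u` is a unit), the ring
`R[T]/(T^p - u)` is a regular local ring. [cite: Matsumura1987, Thm. 23.7 (ii)] -/
theorem isRegularLocalRing_adjoinRoot_X_pow_sub_C_of_forall_pow_ne {p : ℕ} (hp : p.Prime) (u : R)
    (hu : ∀ b : ResidueField R, b ^ p ≠ residue R u) :
    IsRegularLocalRing (AdjoinRoot (X ^ p - C u : R[X])) := by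
  have hirr : Irreducible ((X ^ p - C u : R[X]).map (residue R)) := by
    rw [Polynomial.map_sub, Polynomial.map_pow, map_X, map_C]
    exact X_pow_sub_C_irreducible_of_prime hp hu
  exact isRegularLocalRing_adjoinRoot_of_irreducible_map _ (monic_X_pow_sub_C u hp.ne_zero) hirr

section Embedded

variable {K : Type u} [Field K] [Algebra R K]

/-- **Lemma U, embedded form.** Let `R` be a regular local ring inside a field `K`
(`algebraMap R K` injective), `p` a prime, `u ∈ R` with residue not a `p`-th power, and `a ∈ K`
with `a ^ p = u`. Then `T ↦ a` is an `R`-algebra isomorphism `R[T]/(T^p - u) ≅ R[a] ⊆ K`: the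
evaluation map is injective because its source is a regular local ring, hence a domain, integral
over `R`, so that its kernel — a prime lying over `0` — is zero.
[cite: Matsumura1987, Thm. 23.7 (ii); Thm. 14.3] -/
theorem nonempty_algEquiv_adjoinRoot_adjoin (hinj : Function.Injective (algebraMap R K))
    {p : ℕ} (hp : p.Prime) (u : R) (hu : ∀ b : ResidueField R, b ^ p ≠ residue R u) (a : K)
    (ha : a ^ p = algebraMap R K u) :
    Nonempty (AdjoinRoot (X ^ p - C u : R[X]) ≃ₐ[R] Algebra.adjoin R {a}) := by
  set P : R[X] := X ^ p - C u with hPdef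
  have hP : P.Monic := monic_X_pow_sub_C u hp.ne_zero
  have hroot : P.eval₂ (Algebra.ofId R K : R →+* K) a = 0 := by
    change P.eval₂ (algebraMap R K) a = 0
    simp [hPdef, eval₂_sub, eval₂_X_pow, eval₂_C, ha]
  haveI hreg : IsRegularLocalRing (AdjoinRoot P) :=
    isRegularLocalRing_adjoinRoot_X_pow_sub_C_of_forall_pow_ne hp u hu
  haveI : IsDomain (AdjoinRoot P) := isDomain_of_isRegularLocalRing (AdjoinRoot P)
  haveI : Module.Finite R (AdjoinRoot P) := (AdjoinRoot.powerBasis' hP).finite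
  haveI : Algebra.IsIntegral R (AdjoinRoot P) := Algebra.IsIntegral.of_finite R _
  let ψ : AdjoinRoot P →ₐ[R] K := AdjoinRoot.liftAlgHom P (Algebra.ofId R K) a hroot
  have hψof : ∀ x : R, ψ (AdjoinRoot.of P x) = algebraMap R K x := fun x => by
    change AdjoinRoot.liftAlgHom P (Algebra.ofId R K) a hroot (AdjoinRoot.of P x) = _
    rw [AdjoinRoot.liftAlgHom_of]
    rfl
  have hker : RingHom.ker (ψ : AdjoinRoot P →+* K) = ⊥ := by
    refine Ideal.eq_bot_of_comap_eq_bot (R := R) ?_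
    refine eq_bot_iff.mpr fun x hx => ?_
    rw [Ideal.mem_comap, RingHom.mem_ker, AdjoinRoot.algebraMap_eq] at hx
    have hx' : algebraMap R K x = 0 := by rw [← hψof]; exact hx
    exact (Ideal.mem_bot).mpr (hinj (by rw [hx', map_zero]))
  have hψinj : Function.Injective ψ := fun x y hxy =>
    (RingHom.injective_iff_ker_eq_bot (ψ : AdjoinRoot P →+* K)).mpr hker hxy
  have hrange : ψ.range = Algebra.adjoin R {a} := by
    rw [Algebra.adjoin_singleton_eq_range_aeval]
    ext x
    constructor
    · rintro ⟨y, rfl⟩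
      obtain ⟨g, rfl⟩ := AdjoinRoot.mk_surjective y
      exact ⟨g, by
        change aeval a g = AdjoinRoot.liftAlgHom P (Algebra.ofId R K) a hroot (AdjoinRoot.mk P g)
        rw [AdjoinRoot.liftAlgHom_mk, aeval_def]; rfl⟩
    · rintro ⟨g, rfl⟩
      exact ⟨AdjoinRoot.mk P g, by
        change AdjoinRoot.liftAlgHom P (Algebra.ofId R K) a hroot (AdjoinRoot.mk P g) = aeval a g
        rw [AdjoinRoot.liftAlgHom_mk, aeval_def]; rfl⟩
  exact ⟨(AlgEquiv.ofInjective ψ hψinj).trans (Subalgebra.equivOfEq _ _ hrange)⟩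

/-- Hence `R[a] ⊆ K` is a regular local ring. [cite: Matsumura1987, Thm. 23.7 (ii)] -/
theorem isRegularLocalRing_adjoin_of_forall_pow_ne (hinj : Function.Injective (algebraMap R K))
    {p : ℕ} (hp : p.Prime) (u : R) (hu : ∀ b : ResidueField R, b ^ p ≠ residue R u) (a : K)
    (ha : a ^ p = algebraMap R K u) : IsRegularLocalRing (Algebra.adjoin R {a}) := by
  obtain ⟨e⟩ := nonempty_algEquiv_adjoinRoot_adjoin hinj hp u hu a ha
  haveI := isRegularLocalRing_adjoinRoot_X_pow_sub_C_of_forall_pow_ne hp u hu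
  exact IsRegularLocalRing.of_ringEquiv e.toRingEquiv

/-- … with maximal ideal generated by `𝔪_R` (the closed fibre of `R → R[a]` is the field
`k_R(ū^{1/p})`), so that `R[a]` is dominated by every valuation ring dominating `R`.
[cite: Matsumura1987, Thm. 23.7 (ii)] -/
theorem maximalIdeal_adjoin_of_forall_pow_ne (hinj : Function.Injective (algebraMap R K))
    {p : ℕ} (hp : p.Prime) (u : R) (hu : ∀ b : ResidueField R, b ^ p ≠ residue R u) (a : K)
    (ha : a ^ p = algebraMap R K u) :
    (haveI := isRegularLocalRing_adjoin_of_forall_pow_ne hinj hp u hu a ha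
     maximalIdeal (Algebra.adjoin R {a})) =
      (maximalIdeal R).map (algebraMap R (Algebra.adjoin R {a})) := by
  haveI hS := isRegularLocalRing_adjoin_of_forall_pow_ne hinj hp u hu a ha
  obtain ⟨e⟩ := nonempty_algEquiv_adjoinRoot_adjoin hinj hp u hu a ha
  set P : R[X] := X ^ p - C u with hPdef
  have hP : P.Monic := monic_X_pow_sub_C u hp.ne_zero
  have hirr : Irreducible (P.map (residue R)) := by
    rw [hPdef, Polynomial.map_sub, Polynomial.map_pow, map_X, map_C]
    exact X_pow_sub_C_irreducible_of_prime hp hu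
  haveI hreg : IsRegularLocalRing (AdjoinRoot P) :=
    isRegularLocalRing_adjoinRoot_X_pow_sub_C_of_forall_pow_ne hp u hu
  have h1 : maximalIdeal (AdjoinRoot P) = (maximalIdeal R).map (algebraMap R (AdjoinRoot P)) := by
    have h := maximalIdeal_adjoinRoot P hP hirr
    rw [AdjoinRoot.algebraMap_eq]
    convert h using 0
  rw [← map_ringEquiv_maximalIdeal e.toRingEquiv, h1]
  change Ideal.map e.toRingEquiv.toRingHom
      (Ideal.map (algebraMap R (AdjoinRoot P)) (maximalIdeal R)) = _
  rw [Ideal.map_map]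
  congr 1
  exact RingHom.ext fun x => e.commutes x

end Embedded


/-! ## The exit in the language of the core step (`RelMuPTorsorCoreStepsAt`) -/

section ModelForm

variable {k K : Type} [Field k] [Field K] [Algebra k K]

/-- Elements of `𝔪_T · T[a″]`, for `T ⊆ T[a″] ⊆ O` with `T` dominated by `O`, have positive
value. [folklore] -/
theorem valuation_lt_one_of_mem_map_maximalIdeal (O : ValuationSubring K) {T : Subring K}
    [IsLocalRing T] (hT : ∀ t : T, t ∈ maximalIdeal T → O.valuation (t : K) < 1)
    (S : Subalgebra T K) (hSO : ∀ s : S, O.valuation (s : K) ≤ 1)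
    {s : S} (hs : s ∈ (maximalIdeal T).map (algebraMap T S)) : O.valuation (s : K) < 1 := by
  refine Submodule.span_induction (p := fun s _ => O.valuation ((s : S) : K) < 1) ?_ ?_ ?_ ?_ hs
  · rintro _ ⟨t, ht, rfl⟩
    exact hT t ht
  · simp
  · intro x y _ _ hx hy
    exact Valuation.map_add_lt _ hx hy
  · intro r x _ hx
    change O.valuation (((r * x : S) : K)) < 1
    rw [Subalgebra.coe_mul, map_mul]
    calc O.valuation (r : K) * O.valuation ((x : S) : K)
        ≤ 1 * O.valuation ((x : S) : K) := mul_le_mul_of_nonneg_right (hSO r) zero_le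
      _ < 1 := by rw [one_mul]; exact hx

/-- **Lemma U solves the core step at a residually inseparable presentation.** In the setting of
`RelMuPTorsorCoreStepsAt p k O` (`A₀ ⊆ O` finitely generated over `k`, regular at the centre of
`O`; `a ^ p ∈ A₀`) suppose `a ^ p = q ^ p + m ^ p · u` with `q, m, u ∈ A₀`, `m ≠ 0`, and `b ^ p - u`
a unit of `O` for every `b` in `T = (A₀)_{𝔪_O ∩ A₀}` (the residue of `u` is not a `p`-th power in
the residue field of `T`). Then `A := A₀[a″]`, `a″ = (a - q)/m`, is a finitely generated model
`A₀ ⊆ A ∋ a` inside `k(A₀, a) ∩ O` whose local ring at the centre of `O` is the regular local ring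
`T[a″] ≅ T[X]/(X^p - u)` of Lemma U. [cite: Matsumura1987, Thm. 23.7 (ii)] -/
theorem exists_model_of_residuallyInseparablePresentation {p : ℕ} [hp : Fact p.Prime] [CharP K p]
    (O : ValuationSubring K) (A₀ : Subalgebra k K) (h₀ : A₀.toSubring ≤ O.toSubring)
    (hA₀fg : A₀.FG)
    (hreg :
      IsRegularLocalRing (Localization.AtPrime ((maximalIdeal O).comap (Subring.inclusion h₀))))
    {a q m u : K} (hq : q ∈ A₀) (hm : m ∈ A₀) (hm0 : m ≠ 0) (hu : u ∈ A₀)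
    (hf : a ^ p = q ^ p + m ^ p * u)
    (hres : ∀ b ∈ locAtCentre A₀.toSubring O, O.valuation (b ^ p - u) = 1) :
    ∃ (A : Subalgebra k K) (h : A.toSubring ≤ O.toSubring), A₀ ≤ A ∧ a ∈ A ∧ A.FG ∧
      (A : Set K) ⊆ IntermediateField.adjoin k (insert a (A₀ : Set K)) ∧
      IsRegularLocalRing (Localization.AtPrime ((maximalIdeal O).comap (Subring.inclusion h))) := by
  classical
  set T : Subring K := locAtCentre A₀.toSubring O with hTdef
  haveI hT : IsRegularLocalRing T := (isRegularLocalRing_locAtCentre_iff h₀).mpr hreg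
  have hTO : T ≤ O.toSubring := locAtCentre_le h₀
  set a'' : K := (a - q) / m with ha''def
  have hmp : m ^ p ≠ 0 := pow_ne_zero p hm0
  have ha''p : a'' ^ p = u := by
    rw [ha''def, div_pow, sub_pow_char (p := p) a q, hf]
    field_simp; ring
  have haeq : a = q + m * a'' := by rw [ha''def, mul_div_cancel₀ _ hm0]; ring
  have huT : u ∈ T := le_locAtCentre _ O hu
  set uT : T := ⟨u, huT⟩ with huTdef
  have hinj : Function.Injective (algebraMap T K) := fun x y hxy => Subtype.ext hxy
  have hres' : ∀ b : ResidueField T, b ^ p ≠ residue T uT := by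
    intro b hb
    obtain ⟨b, rfl⟩ := residue_surjective b
    have hb0 : residue T (b ^ p - uT) = 0 := by rw [map_sub, map_pow, hb, sub_self]
    have hmem : b ^ p - uT ∈ maximalIdeal T := (residue_eq_zero_iff _).mp hb0
    have hlt : O.valuation (((b ^ p - uT : T)) : K) < 1 :=
      (not_isUnit_locAtCentre_iff h₀ _).mp ((mem_maximalIdeal _).mp hmem)
    exact hlt.ne (hres b b.2)
  have ha''K : a'' ^ p = algebraMap T K uT := by rw [ha''p]; rfl
  haveI hSreg : IsRegularLocalRing (Algebra.adjoin T {a''}) :=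
    isRegularLocalRing_adjoin_of_forall_pow_ne hinj hp.out uT hres' a'' ha''K
  have hSmax := maximalIdeal_adjoin_of_forall_pow_ne hinj hp.out uT hres' a'' ha''K
  set S : Subring K := (Algebra.adjoin T {a''}).toSubring with hSdef
  have ha''O : a'' ∈ O := by
    rw [← O.valuation_le_one_iff]
    by_contra hlt
    rw [not_le] at hlt
    have h1 : 1 < O.valuation (a'' ^ p) := by rw [map_pow]; exact one_lt_pow₀ hlt hp.out.ne_zero
    rw [ha''p] at h1
    exact (not_lt.mpr ((O.valuation_le_one_iff u).mpr (h₀ hu))) h1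
  have hSO : S ≤ O.toSubring := by
    rw [hSdef, Algebra.adjoin_eq_ring_closure]
    refine Subring.closure_le.mpr ?_
    rintro x (⟨t, rfl⟩ | hx)
    · exact hTO t.2
    · rw [Set.mem_singleton_iff] at hx; rw [hx]; exact ha''O
  have hSunit : ∀ z ∈ S, O.valuation z = 1 → z⁻¹ ∈ S := by
    intro z hz hvz
    have hz' : z ∈ Algebra.adjoin T {a''} := hz
    set zS : Algebra.adjoin T {a''} := ⟨z, hz'⟩ with hzSdef
    by_cases hzu : IsUnit zS
    · obtain ⟨w, hw⟩ := hzu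
      have hwinv : ((↑(w⁻¹) : Algebra.adjoin T {a''}) : K) = z⁻¹ := by
        have hmul : z * ((↑(w⁻¹) : Algebra.adjoin T {a''}) : K) = 1 := by
          have := congrArg (fun t : Algebra.adjoin T {a''} => (t : K)) w.mul_inv
          simpa [hw] using this
        exact (eq_inv_of_mul_eq_one_right hmul)
      rw [← hwinv]
      exact (↑(w⁻¹) : Algebra.adjoin T {a''}).2
    · exfalso
      have hmem : zS ∈ maximalIdeal (Algebra.adjoin T {a''}) := (mem_maximalIdeal _).mpr hzu
      rw [hSmax] at hmem
      have hT' : ∀ t : T, t ∈ maximalIdeal T → O.valuation (t : K) < 1 := fun t ht =>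
        (not_isUnit_locAtCentre_iff h₀ t).mp ((mem_maximalIdeal _).mp ht)
      have hlt := valuation_lt_one_of_mem_map_maximalIdeal O hT' (Algebra.adjoin T {a''})
        (fun s => (O.valuation_le_one_iff _).mpr (hSO s.2)) hmem
      exact (hlt : O.valuation z < 1).ne hvz
  set A : Subalgebra k K := Algebra.adjoin k (insert a'' (A₀ : Set K)) with hAdef
  have hA₀A : A₀ ≤ A := fun x hx => Algebra.subset_adjoin (Set.mem_insert_of_mem a'' hx)
  have ha''A : a'' ∈ A := Algebra.subset_adjoin (Set.mem_insert a'' _)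
  have haA : a ∈ A := by rw [haeq]; exact A.add_mem (hA₀A hq) (A.mul_mem (hA₀A hm) ha''A)
  have hA₀T : A₀.toSubring ≤ T := le_locAtCentre _ O
  have hTS : T ≤ S := fun t ht => (Algebra.adjoin T {a''}).algebraMap_mem ⟨t, ht⟩
  have ha''S : a'' ∈ S := Algebra.self_mem_adjoin_singleton T a''
  have hAS : A.toSubring ≤ S := by
    rw [hAdef, Algebra.adjoin_eq_ring_closure]
    refine Subring.closure_le.mpr ?_
    rintro x (⟨c, rfl⟩ | hx)
    · exact hTS (hA₀T (A₀.algebraMap_mem c))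
    · rcases hx with rfl | hx
      · exact ha''S
      · exact hTS (hA₀T hx)
  have hloc : locAtCentre A.toSubring O = S := by
    refine le_antisymm ?_ ?_
    · rintro _ ⟨y, hy, z, hz, hv, rfl⟩
      rw [div_eq_mul_inv]
      exact S.mul_mem (hAS hy) (hSunit z (hAS hz) hv)
    · rw [hSdef, Algebra.adjoin_eq_ring_closure]
      refine Subring.closure_le.mpr ?_
      rintro x (⟨t, rfl⟩ | hx)
      · exact locAtCentre_mono O (show A₀.toSubring ≤ A.toSubring from hA₀A) t.2
      · rw [Set.mem_singleton_iff] at hx; rw [hx]; exact le_locAtCentre _ O ha''A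
  have hAO : A.toSubring ≤ O.toSubring := (le_locAtCentre _ O).trans (hloc ▸ hSO)
  have hAfg : A.FG := by
    obtain ⟨s, hs⟩ := hA₀fg
    rw [show A = Algebra.adjoin k ↑(insert a'' s) by
      rw [hAdef, Finset.coe_insert, ← hs, Algebra.adjoin_insert_adjoin]]
    exact Subalgebra.fg_adjoin_finset _
  have hAF : (A : Set K) ⊆ IntermediateField.adjoin k (insert a (A₀ : Set K)) := by
    change A ≤ (IntermediateField.adjoin k (insert a (A₀ : Set K))).toSubalgebra
    rw [hAdef]
    refine Algebra.adjoin_le ?_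
    intro x hx
    rw [SetLike.mem_coe, IntermediateField.mem_toSubalgebra]
    rcases hx with rfl | hx
    · rw [ha''def]
      refine div_mem (sub_mem ?_ ?_) ?_
      · exact IntermediateField.subset_adjoin k _ (Set.mem_insert a _)
      · exact IntermediateField.subset_adjoin k _ (Set.mem_insert_of_mem a hq)
      · exact IntermediateField.subset_adjoin k _ (Set.mem_insert_of_mem a hm)
    · exact IntermediateField.subset_adjoin k _ (Set.mem_insert_of_mem a hx)
  have hregA : IsRegularLocalRing (locAtCentre A.toSubring O) := by rw [hloc]; exact hSreg
  exact ⟨A, hAO, hA₀A, haA, hAfg, hAF, (isRegularLocalRing_locAtCentre_iff hAO).mp hregA⟩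

/-- **Lemma U discharges the residually inseparable instances of the core**: in characteristic
`p`, `RelMuPTorsorCoreStepsAt p k O` is equivalent to the same statement restricted to the
instances `(A₀, a)` which admit NO residually inseparable presentation
`a ^ p = q ^ p + m ^ p · u` over `A₀` (`q, m, u ∈ A₀`, `m ≠ 0`, `b ^ p - u` a unit of `O` for all
`b` in the local ring of `A₀` at the centre) — the only instances a proof of the core still has
to treat. [cite: Matsumura1987, Thm. 23.7 (ii)] -/
theorem relMuPTorsorCoreStepsAt_iff_noUExit {p : ℕ} [Fact p.Prime] [CharP K p]
    (O : ValuationSubring K) :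
    RelMuPTorsorCoreStepsAt p k O ↔
      (∀ (A₀ : Subalgebra k K) (h₀ : A₀.toSubring ≤ O.toSubring) (a : K), A₀.FG →
        IsRegularLocalRing (Localization.AtPrime ((maximalIdeal O).comap (Subring.inclusion h₀))) →
        a ∉ IntermediateField.adjoin k (A₀ : Set K) → a ^ p ∈ A₀ →
        3 < Algebra.trdeg k ↥(IntermediateField.adjoin k (insert a (A₀ : Set K))) →
        ¬ IsAbhyankarPlace
            (O.comap (algebraMap ↥(IntermediateField.adjoin k (insert a (A₀ : Set K))) K))
            (algebraMap k ↥(IntermediateField.adjoin k (insert a (A₀ : Set K)))).fieldRange ⊤ →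
        (¬ ∃ q m u : K, q ∈ A₀ ∧ m ∈ A₀ ∧ m ≠ 0 ∧ u ∈ A₀ ∧ a ^ p = q ^ p + m ^ p * u ∧
            ∀ b ∈ locAtCentre A₀.toSubring O, O.valuation (b ^ p - u) = 1) →
        ∃ (A : Subalgebra k K) (h : A.toSubring ≤ O.toSubring), A₀ ≤ A ∧ a ∈ A ∧ A.FG ∧
          (A : Set K) ⊆ IntermediateField.adjoin k (insert a (A₀ : Set K)) ∧
          IsRegularLocalRing
            (Localization.AtPrime ((maximalIdeal O).comap (Subring.inclusion h)))) := by
  constructor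
  · intro H A₀ h₀ a hfg hreg hna hap htr hnA _
    exact H A₀ h₀ a hfg hreg hna hap htr hnA
  · intro H A₀ h₀ a hfg hreg hna hap htr hnA
    by_cases hex : ∃ q m u : K, q ∈ A₀ ∧ m ∈ A₀ ∧ m ≠ 0 ∧ u ∈ A₀ ∧
        a ^ p = q ^ p + m ^ p * u ∧ ∀ b ∈ locAtCentre A₀.toSubring O, O.valuation (b ^ p - u) = 1
    · obtain ⟨q, m, u, hq, hm, hm0, hu, hf, hres⟩ := hex
      exact exists_model_of_residuallyInseparablePresentation O A₀ h₀ hfg hreg hq hm hm0 hu hf hres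
    · exact H A₀ h₀ a hfg hreg hna hap htr hnA hex

/-- **The summit, with the residually inseparable exits removed from its local core.** Granted
Temkin's inseparable local uniformization in height one and Cossart–Piltant in dimension `≤ 3`
(as in `SoloInformedRankOne`), resolution of singularities in positive characteristic is
EQUIVALENT to two-model patching of proper models together with the core model-form
`μ_p`-torsor steps at rank-one valuation rings — at the instances WITHOUT a residually
inseparable presentation only (Lemma U solves the others).
[cite: Matsumura1987, Thm. 23.7 (ii); Temkin2013, Thm. 1.3.2; CossartPiltant2019, Thm. 1.1] -/
theorem resolutionOfSingularities_iff_twoModelPatching_and_rankOneNoUExitCoreSteps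
    (hT₁ : Temkin2013HeightLeOne.{0}) (hCP : CossartPiltant2019LU3.{0}) :
    Literature.AlgebraicGeometry.Resolution.ResolutionOfSingularities ↔
      ∀ p : ℕ, p.Prime → ProperModel.TwoModelPatching.{0} p ∧
      (∀ (k K : Type) [Field k] [CharP k p] [Field K] [Algebra k K],
        (⊤ : IntermediateField k K).FG → ∀ O : ValuationSubring K,
          Nonempty O.valuation.RankOne → (∀ c : k, algebraMap k K c ∈ O) →
            (∀ (A₀ : Subalgebra k K) (h₀ : A₀.toSubring ≤ O.toSubring) (a : K), A₀.FG →
            IsRegularLocalRing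
              (Localization.AtPrime ((maximalIdeal O).comap (Subring.inclusion h₀))) →
            a ∉ IntermediateField.adjoin k (A₀ : Set K) → a ^ p ∈ A₀ →
            3 < Algebra.trdeg k ↥(IntermediateField.adjoin k (insert a (A₀ : Set K))) →
            ¬ IsAbhyankarPlace
                (O.comap (algebraMap ↥(IntermediateField.adjoin k (insert a (A₀ : Set K))) K))
                (algebraMap k ↥(IntermediateField.adjoin k (insert a (A₀ : Set K)))).fieldRange ⊤ →
            (¬ ∃ q m u : K, q ∈ A₀ ∧ m ∈ A₀ ∧ m ≠ 0 ∧ u ∈ A₀ ∧ a ^ p = q ^ p + m ^ p * u ∧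
                ∀ b ∈ locAtCentre A₀.toSubring O, O.valuation (b ^ p - u) = 1) →
            ∃ (A : Subalgebra k K) (h : A.toSubring ≤ O.toSubring), A₀ ≤ A ∧ a ∈ A ∧ A.FG ∧
              (A : Set K) ⊆ IntermediateField.adjoin k (insert a (A₀ : Set K)) ∧
              IsRegularLocalRing
                (Localization.AtPrime ((maximalIdeal O).comap (Subring.inclusion h))))) := by
  rw [resolutionOfSingularities_iff_twoModelPatching_and_rankOneRelCoreSteps hT₁ hCP]
  refine forall₂_congr fun p hp => and_congr_right fun _ => forall₂_congr fun k K => ?_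
  refine forall₄_congr fun _ _ _ _ => forall₃_congr fun _ O _ => forall_congr' fun _ => ?_
  haveI : Fact p.Prime := ⟨hp⟩
  haveI : CharP K p := charP_of_injective_algebraMap (algebraMap k K).injective p
  exact relMuPTorsorCoreStepsAt_iff_noUExit O

end ModelForm

end Summit.ResolutionOfSingularities.ResolutionOfSingularities.Theorems

end
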